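/-
Copyright: statement-level skeleton of a published paper (lit-balaban cell, Phase-2 proof seat p39 gen 31). No proof claims
beyond what the kernel checks below.
-/
import Literature.MathematicalPhysics.QuantumFieldTheory.Balaban1983to89.B3Eq119JointSmooth
import Literature.MathematicalPhysics.QuantumFieldTheory.Balaban1983to89.B3Eq123IndexTwoOne

/-!
# Bałaban, *(Higgs)₂,₃ quantum fields in a finite volume. III*, CMP 88 (1983) [Balaban1983Higgs3], p. 417: THE INDEX `(2,1)` OF
# PRINT'S RECURSION (1.23) IN BOTH ORDERS OF DIFFERENTIATION — BRICK 14's «`e` first» datum `∂_λ⁺[∂²_e G^{ct}(·,λ)∣₀](0⁺)` IS the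
# «`λ` first» coefficient `∂²_e[∂_λ⁺G^{ct}(e,·)(0⁺)]∣₀` of BRICK 11's two-variable Taylor formula of (1.19), by Schwarz's theorem
# within the slab; the same for EVERY index `(α,β)` of the polynomial counterterm of (1.23), and for the vacuum energy (1.24)

statement-level skeleton of published theorems with citation tags; proofs where landed; nothing here is a claim about the
Yang–Mills mass gap.

[cite: Balaban1983Higgs3, (1.23) and the prose around it p.417 (PDF 7); (1.19)–(1.21) p.416 (PDF 6)].  Unit `lit-balaban-p39-g31`
(Phase-2 proof seat p39, gen 31), free-target protocol G.5-34(d), ZERO head weight: OPTIONAL LOCATED MEMBER of rows **B3.Eq1.23**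
(the `(2,1)` step of *"solved recursively"*) and **B3.Eq1.19-1.22** of `HOME/lit-balaban-r15/ROWS-B3.md` (owner r15; heads
unchanged) — item (D) of the gen-30 successor menu `HOME/lit-balaban-p39/DESIGN-weight6-next.md` («BRICK 14's two-point (2,1)
datum in the body-of-record order»), done NOT by a second computation but by the order-independence theorem.  BRICK 18 of this
seat's series.  IMPORTED: BRICK 11 `B3Eq119JointSmooth` (the two-point function (1.19) with a jointly smooth counterterm
`ct(e,λ)` inserted, `twoPtCt`, is jointly `C^n` on a slab `I ×ˢ Λ`; Schwarz within the slab
`iteratedDeriv_iteratedDerivWithin_twoPtCt_comm`; the two-variable Taylor formula `twoPtCt_taylor`) and BRICK 14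
`B3Eq123IndexTwoOne` (print's recursion at `(2,1)` with `δm² = δm²_{(2,0)}e² + δm²_{(0,1)}λ + δm²_{(2,1)}e²λ + δm²_{(4,0)}e⁴` inserted:
`hasDerivWithinAt_index21`, `derivWithin_index21_explicit`, `index21_eq_local_insertion`, `condition_21_iff`), both built on the
Lean farm when this file was drafted (importer probes rc 0, 2026-08-24T17:3xZ); through them BRICK 7 `B3Eq122ChargeWick` (`J`,
`legs`, `weight`, `G`, `C0`, `Bk`, `trE`) and the tree's generic `Literature.Analysis.Calculus.MixedPartialDerivWithin`, whose §6
(`iteratedDeriv_iteratedDerivWithin_comm_openFst`, Schwarz within a slab with an open first factor — filed by this seat the same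
session, p383793, at the typer's request) §5 uses BY NAME.  Nothing of record is redeclared; theorems only (no definition, no named
fact, no `sorry`; standard axioms).

PDF held: `paper:balaban1983-higgs-2-3-quantum-fields-finite-volume` (journal page = PDF page + 410); p. 417 as read for BRICKS
14/16 on the ×2 render `run/shared/lean/pub/pub-balaban/b2b-balaban-ref1/pages/1983-cmp88-higgs23-III/1983-cmp88-higgs23-III-
p007-x2.png` (quoted verbatim in BRICK 14's header: *"This equation can be solved recursively if δm² and Σ^ε are expanded into power
series in e, λ. … More exactly we write δm² = Σ_{2≦α+2β≦4} e^αλ^β δm²_{(α,β)} … The counterterms δm²_{(α,β)} are defined by the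
equations −δm²_{(α,β)} + Σ_{x∈T_ε}ε^dΣ^ε_{(α,β)}(x) = 0."*).

THE POINT OF THIS FILE.  A coefficient of a *"power series in e, λ"* (p. 417) of the two-point function `G^{ct}(e,λ)` — (1.19) for
the action (1.20) at charge `e`, quartic coupling `λ ≥ 0`, WITH print's polynomial counterterm `δm²(e,λ) = δm²_{(2,0)}e² +
δm²_{(0,1)}λ + δm²_{(2,1)}e²λ + δm²_{(4,0)}e⁴` inserted — is, on the finite lattice, an ITERATED MIXED PARTIAL at `(e,λ) = (0,0⁺)`, the
`λ`-derivatives ONE-SIDED (the quartic weight `e^{−λΣη^d∣φ∣⁴}` is integrable for `λ ≥ 0` only).  Two iterated partials are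
available for the index `(α,β)`: «`λ` first» `∂^α_e[∂^β_{λ,+}G^{ct}(e,·)(0)]∣_{e=0}` = Mathlib's
`iteratedDeriv α (fun e ↦ iteratedDerivWithin β (fun λ ↦ G^{ct}(e,λ)) (Set.Ici 0) 0) 0` — the order of BRICK 11's two-variable Taylor
formula `twoPtCt_taylor` (every coefficient `(α!(i−α)!)⁻¹e^αλ^{i−α}·∂^α_e∂^{i−α}_{λ,Λ}G^{ct}(0,0)` is of this shape) and of the
vacuum-energy BRICKS 16/17 (`E1of124R`, the body of record of (1.24)), and «`e` first» `∂^β_{λ,+}[∂^α_eG^{ct}(·,λ)∣₀](0⁺)` =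
`iteratedDerivWithin β (fun λ ↦ iteratedDeriv α (fun e ↦ G^{ct}(e,λ)) 0) (Set.Ici 0) 0` — the order in which BRICK 14 DERIVED and
EVALUATED the index `(2,1)` (`derivWithin (λ ↦ iteratedDeriv 2 (e ↦ G^{ct}(e,λ)) 0) (Set.Ici 0) 0`).  THIS FILE PROVES THE TWO
AGREE, for every `(α,β)` (§3 `iteratedDeriv_iteratedDerivWithin_comm_poly`), so that BRICK 14's closed form IS the `(2,1)` Taylor
coefficient (times `2!1!`) of (1.19) in `(e,λ)` at `(0,0⁺)` (§4 `index21_orders_agree`, `iteratedDeriv_two_derivWithin_explicit`),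
and print's defining equation at `(2,1)` reads the same in either order (§4 `condition_21_iff_lamFirst`).  MECHANISM: BRICK 11
proved (1.19) jointly `C^∞` in `(e,λ)` on any slab `I ×ˢ Λ` where the running mass `m² + ct(e,λ)` stays positive, with
Schwarz's theorem WITHIN the slab at `(e₀, 0)`, `0 ∈ Λ ∩ closure (interior Λ)` (Coleman, *Calculus on Normed Vector Spaces* §4.1 Thm
4.3 in the within-a-product form of `Literature.Analysis.Calculus.MixedPartialDerivWithin`); for the polynomial counterterm the running
mass is `≥ m²/2` on the slab `(−r, r) ×ˢ [0, δ]` of §2 (explicit `r, δ > 0` in the letters `δm²_{(α,β)}` and `m²`), and the one-sided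
derivatives at `λ = 0` within `[0, δ]` and within `[0, ∞)` coincide (locality, §2) — print's `δm²_{(0,1)} = −4(N+2)C^ε_0(0)` is
NEGATIVE, so positivity of the running mass genuinely needs `λ` small: the slab, not the quadrant.

WHICH TERM OF (1.23) THIS IS; THE DOMAIN OF THE IDENTIFICATION (owner r15's asks, 2026-08-24T17:38Z).  The term: the `e²λ`
coefficient of the two-point function (1.19) along print's counterterm surface — index `(α,β) = (2,1)` of p. 417's set
`2 ≤ α+2β ≤ 4` — which is `(2!1!)⁻¹` times either iterated partial above.  (i) DOMAIN.  The slab is `(−r, r) ×ˢ [0, δ]` with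
`r = min 1 (m²/(4(∣δm²_{(2,0)}∣+∣δm²_{(2,1)}∣+∣δm²_{(4,0)}∣)+4))` chosen from `m²` and the `e`-carrying letters only and
`δ = min 1 (m²/(4∣δm²_{(0,1)}∣+4))` from `m²` and the pure-`λ` letter only, INDEPENDENTLY of each other (§2; for §5's six-letter polynomial
`r₆`, `δ₆` likewise, `δ₆` from `∣δm²_{(0,1)}∣+∣δm²_{(0,2)}∣`); on it `∣δm²(e,λ)∣ ≤ m²/2` (`abs_poly_le`), so the running mass is `≥ m²/2`
(`poly_slab_pos`) — the hypothesis under which BRICK 11's Gaussian domination, joint smoothness and Schwarz theorem hold; print's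
`δm²_{(0,1)} = −4(N+2)C^ε_0(0)` is NEGATIVE, which is what forces `λ` small (at `λ` beyond `≈ m²/∣δm²_{(0,1)}∣` the running mass
changes sign; the quartic term still makes the integrals converge there, but that regime is outside BRICK 11).  The identification is
a statement AT THE POINT `(e₀, 0⁺)`: the one-sided `λ`-derivatives at `0` taken within `[0, δ]` and within `[0, ∞)` coincide for
every function (`iteratedDerivWithin_Ici_eq_Icc_zero`, = Mathlib's `iteratedFDerivWithin_congr_set`: the two constraint sets agree
near `0`), so the headline statements are written within `Set.Ici 0`, exactly as BRICKS 14/16/17 write theirs, and hold at every base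
charge `∣e₀∣ < r` (`iteratedDeriv_iteratedDerivWithin_comm_poly_at`), in particular at `e₀ = 0`.  (ii) SCOPE.
`iteratedDeriv_iteratedDerivWithin_comm_poly` covers EVERY `(α,β)` — all orders, not only weight `≤ 4` — for the two-point function
with THIS polynomial inserted (the weight-`≤ 4` letters `δm²_{(2,0)}, δm²_{(0,1)}, δm²_{(2,1)}, δm²_{(4,0)}` of (1.23)); §5
`iteratedDeriv_iteratedDerivWithin_logZct_comm_poly6` does the same for the VACUUM side `log Z^{ct}` with BRICK 17's six letters
(`+ δm²_{(0,2)}λ² + δm²_{(2,2)}e²λ²`), every `(α,β)` — so the `E1of124R`-order data of BRICKS 16/17 and any «e first» evaluation are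
interchangeable, and a successor taking `(4,0)`, `(4,1)`, `(6,0)` of p. 418's window has the order-independence available as is,
PROVIDED the inserted counterterm is a polynomial in these six letters; if the weight-6 letters (`δm²_{(4,1)}e⁴λ`, `δm²_{(6,0)}e⁶`,
`δm²_{(0,3)}λ³`, …) are inserted too, re-run `contDiff_poly6` / `abs_poly6_le` with the longer polynomial — the ONLY two places where
its shape enters (BRICK 11's theorems and `MixedPartialDerivWithin` §6 take any jointly smooth `ct` positive on a slab).

THE SETTING = BRICK 14's verbatim (BRICK 7's model torus `T^{(j)}_η` = print's `T_ε`, `w = η^d`, `c = η⁻¹`, scalar fields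
`φ : T → ℝ^N`, the vector field with the Feynman-gauge Gaussian, joint weight `J_e(M)`, propagators `C₀ = G w c m2`, `C^ε = G w c μ2`,
`C^ε_0(0) = C0 w c m2`); the two-point function with the counterterm inserted is BRICK 11's `twoPtCt C η w c m2 μ2 ct (e,λ) a b x x'`
at `ct e λ = d20·e² + d01·λ + d21·(e²λ) + d40·e⁴` (letters `d20 d01 d21 d40` = `δm²_{(2,0)}, δm²_{(0,1)}, δm²_{(2,1)}, δm²_{(4,0)}`,
arbitrary reals unless said), which UNFOLDS (§1 `twoPtCt_poly_eq`, `rfl` up to β-reduction via BRICK 11 `twoPtCt_eq`) to the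
quotient of integrals BRICK 14 writes out in each of its statements.  Hypotheses: `η^d > 0`, `m² > 0`, `μ₀² > 0`; any level `j`,
mesh, dimension, `N`.

WHAT THIS FILE PROVES (theorems only).
* §1 `twoPtCt_poly_eq` — BRICK 14's written-out quotient `= twoPtCt … (e,λ)`; `contDiff_poly` — the counterterm is jointly `C^n`,
  every `n`.
* §2 THE SLAB: `abs_poly_le` (`∣ct(e,λ)∣ ≤ m²/2` for `∣e∣ < r`, `0 ≤ λ ≤ δ`, with `r = min 1 (m²/(4(∣d20∣+∣d21∣+∣d40∣)+4))`,
  `δ = min 1 (m²/(4∣d01∣+4))`), `poly_slab_pos` (`m² + ct > 0` there); locality of the one-sided derivatives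
  `iteratedDerivWithin_Ici_eq_Icc_zero` (`∂^β_{λ,[0,∞)}f(0) = ∂^β_{λ,[0,δ]}f(0)`), `zero_mem_closure_interior_Icc`.
* §3 **`iteratedDeriv_iteratedDerivWithin_comm_poly`: FOR EVERY `(α,β)`, every `a b x x′` and every real `d20 d01 d21 d40`,
  `∂^α_e[∂^β_{λ,+}G^{ct}(e,·)(0)]∣₀ = ∂^β_{λ,+}[∂^α_eG^{ct}(·,λ)∣₀](0⁺)`** (both within `Set.Ici 0` at `0`), and the same at every
  base charge `∣e₀∣ < r` (`…_comm_poly_at`); `contDiffOn_twoPtCt_poly` (jointly `C^∞` on the slab, BRICK 11 by name).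
* §4 THE INDEX `(2,1)`: **`index21_orders_agree`** (`iteratedDeriv 2 (e ↦ derivWithin (λ ↦ G^{ct}(e,λ)) (Ici 0) 0) 0 = derivWithin
  (λ ↦ iteratedDeriv 2 (e ↦ G^{ct}(e,λ)) 0) (Ici 0) 0`, BRICK 14's datum on the right, written out); **`iteratedDeriv_two_derivWithin
  _explicit`** — the «`λ` first» datum IN CLOSED FORM at print's `δm²_{(0,1)}` = BRICK 14 `derivWithin_index21_explicit`'s right-hand
  side verbatim (the Wick-ordered quartic vertex carrying the order-`e²` loop insertion ② + ④ minus the `δm²_{(2,0)}` bubble, and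
  `C₀(−δm²_{(2,1)})C₀`, times `2!1!`); **`index21_lamFirst_eq_local_insertion`** — for `q² = q2·1`, `(2!1!)⁻¹` times the
  «`λ` first» datum `= δ_{ab}Σ_yη^dC₀(x,y)[K(y) − δm²_{(2,1)}]C₀(y,x′)` with BRICK 14's local kernel `K` (its
  `index21_eq_local_insertion` transported), so that print's equation *"−δm²_{(2,1)} + Σ_xε^dΣ^ε_{(2,1)}(x) = 0"* —
  BRICK 14 `condition_21_iff` ⟺ `δm²_{(2,1)} = K(x)`, a statement about the letter `d21` and the kernel `K` alone — constrains
  the «`λ` first» coefficient identically; **`taylorCoeff21_slab_eq_index21`** — the `(α, i−α) = (2,1)` coefficient of BRICK 11's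
  `twoPtCt_taylor` ON THE SLAB of §2 (inner derivative within `[0,δ]`) is BRICK 14's datum.
* §5 THE VACUUM SIDE: `contDiff_poly6`, `abs_poly6_le`, `poly6_slab_pos`, `contDiffOn_logZct_poly6` (`log Z^{ct}` with BRICK 17's
  six-letter polynomial is jointly `C^n` on the slab `(−r₆,r₆) ×ˢ [0,δ₆]`) and **`iteratedDeriv_iteratedDerivWithin_logZct_comm_poly6`**:
  for EVERY `(α,β)`, `∂^α_e[∂^β_{λ,+}log Z^{ct}(e,·)(0)]∣₀ = ∂^β_{λ,+}[∂^α_e log Z^{ct}(·,λ)∣₀](0⁺)` — (1.24)'s `E₁` data in the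
  `E1of124R` order (BRICKS 16/17) and in the «e first» order (BRICK 13) are the same numbers; `contDiffOn_logZct_poly`,
  **`iteratedDeriv_iteratedDerivWithin_logZct_comm_poly`** — the same for BRICKS 14/16's four-letter polynomial.

HONEST SCOPE.  (i) No new graph is evaluated: the values are BRICK 14's, transported across the order of differentiation by BRICK
11's Schwarz theorem; (ii) the index set: §3 covers all `(α,β)`, but closed forms exist in the tree only for `α+2β ≤ 4` minus
`(4,0)` (BRICKS 7/8/10/12/14), on the vacuum side for `α+2β ≤ 4` and `(0,3)`, `(2,2)` (BRICKS 12/13/15/16/17); (iii) `ε → 0`, the 1PI enumeration behind (1.21) and the *"convergent"* claim for `−δm² + Σ^ε` are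
not touched (rows B3.Eq1.19-1.22 / B3.Eq1.23 carry those disclosures); (iv) the slab of §2 is one convenient choice — any slab on
which the running mass stays positive gives the same one-sided derivatives at `(e₀,0)` (§2 locality).
-/

noncomputable section

open scoped BigOperators InnerProductSpace Topology ContDiff

namespace Literature.MathematicalPhysics.QuantumFieldTheory.Balaban1983to89.B3Eq123IndexTwoOneOrders

open _root_.MeasureTheory _root_.Filter Set
open LatticeFieldCalculus B3WT223Instance B3WTPropagator B3WTCovariance B3WickVertexCalculus B3BilinearWick
  B3Eq122ChargeWick B3Eq119JointSmooth B3Eq123IndexTwoOne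

variable {P : Params} {j N : ℕ} (C : HiggsLattice.ChargeData N) (η w c m2 μ2 : ℝ)

/-! ## §1 The polynomial counterterm of (1.23) inserted in BRICK 11's `twoPtCt`: unfolding to BRICK 14's quotient; smoothness -/

section Poly

/-- **BRICK 14's written-out two-point function with `δm² = δm²_{(2,0)}e² + δm²_{(0,1)}λ + δm²_{(2,1)}e²λ + δm²_{(4,0)}e⁴` inserted IS
BRICK 11's `twoPtCt` at the polynomial counterterm** (definitional, via `twoPtCt_eq`). [cite: Balaban1983Higgs3, (1.19)–(1.20) p.416, (1.23) p.417] -/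
theorem twoPtCt_poly_eq (d20 d01 d21 d40 e lam : ℝ) (a b : Fin N) (x x' : Site P j) :
    twoPtCt C η w c m2 μ2 (fun u l => d20 * u ^ 2 + d01 * l + d21 * (u ^ 2 * l) + d40 * u ^ 4) (e, lam) a b x x' =
      (∫ p : JCfg P j N, J C η w c (m2 + (d20 * e ^ 2 + d01 * lam + d21 * (e ^ 2 * lam) + d40 * e ^ 4)) μ2 e p *
          (Real.exp (-(lam * ∑ y : Site P j, w * ‖p.2 y‖ ^ 4)) * legs a b x x' p.2)) /
        ∫ p : JCfg P j N, J C η w c (m2 + (d20 * e ^ 2 + d01 * lam + d21 * (e ^ 2 * lam) + d40 * e ^ 4)) μ2 e p *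
          Real.exp (-(lam * ∑ y : Site P j, w * ‖p.2 y‖ ^ 4)) := by
  rw [twoPtCt_eq]

omit C η w c m2 μ2 in
/-- the polynomial counterterm is jointly `C^n` in `(e,λ)`, every `n`. [cite: Balaban1983Higgs3, (1.23) p.417] -/
theorem contDiff_poly (d20 d01 d21 d40 : ℝ) {n : WithTop ℕ∞} :
    ContDiff ℝ n (fun p : ℝ × ℝ => d20 * p.1 ^ 2 + d01 * p.2 + d21 * (p.1 ^ 2 * p.2) + d40 * p.1 ^ 4) :=
  (((contDiff_const.mul (contDiff_fst.pow 2)).add (contDiff_const.mul contDiff_snd)).add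
    (contDiff_const.mul ((contDiff_fst.pow 2).mul contDiff_snd))).add (contDiff_const.mul (contDiff_fst.pow 4))

end Poly

/-! ## §2 The slab `(−r, r) ×ˢ [0, δ]` on which the running mass stays `≥ m²/2`, and locality of the one-sided derivatives at
`λ = 0` -/

section Slab

omit C η w c m2 μ2

/-- **`∣ct(e,λ)∣ ≤ m²/2` on the slab**: for `∣e∣ < r = min 1 (m²/(4K+4))`, `K = ∣d20∣+∣d21∣+∣d40∣`, and `0 ≤ λ ≤ δ = min 1 (m²/(4∣d01∣+4))`
(`m² > 0`). [cite: Balaban1983Higgs3, (1.20) p.416, (1.23) p.417] -/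
theorem abs_poly_le {m2 : ℝ} (hm : 0 < m2) (d20 d01 d21 d40 : ℝ) {e lam : ℝ}
    (he : e ∈ Ioo (-(min 1 (m2 / (4 * (|d20| + |d21| + |d40|) + 4)))) (min 1 (m2 / (4 * (|d20| + |d21| + |d40|) + 4))))
    (hlam : lam ∈ Icc 0 (min 1 (m2 / (4 * |d01| + 4)))) :
    |d20 * e ^ 2 + d01 * lam + d21 * (e ^ 2 * lam) + d40 * e ^ 4| ≤ m2 / 2 := by
  set K : ℝ := |d20| + |d21| + |d40| with hK
  have hK0 : 0 ≤ K := by positivity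
  set r : ℝ := min 1 (m2 / (4 * K + 4)) with hr
  set δ : ℝ := min 1 (m2 / (4 * |d01| + 4)) with hδ
  have hr1 : r ≤ 1 := min_le_left _ _
  have hr2 : r ≤ m2 / (4 * K + 4) := min_le_right _ _
  have hδ1 : δ ≤ 1 := min_le_left _ _
  have hδ2 : δ ≤ m2 / (4 * |d01| + 4) := min_le_right _ _
  have hr0 : 0 < r := lt_min one_pos (div_pos hm (by positivity))
  have he' : |e| < r := abs_lt.2 he
  have he1 : |e| ≤ 1 := (he'.le.trans hr1)
  have hlam0 : 0 ≤ lam := hlam.1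
  have hlamδ : lam ≤ δ := hlam.2
  have hlam1 : lam ≤ 1 := hlamδ.trans hδ1
  -- `e² ≤ ∣e∣·r ≤ r` and `e⁴ ≤ e² ≤ r`
  have he2 : e ^ 2 ≤ r := by
    have : e ^ 2 = |e| * |e| := by rw [abs_mul_abs_self]; ring
    rw [this]
    calc |e| * |e| ≤ 1 * r := mul_le_mul he1 he'.le (abs_nonneg _) zero_le_one
      _ = r := one_mul r
  have he2' : 0 ≤ e ^ 2 := sq_nonneg e
  have he4 : e ^ 4 ≤ r := by
    have : e ^ 4 = e ^ 2 * e ^ 2 := by ring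
    rw [this]
    calc e ^ 2 * e ^ 2 ≤ 1 * r := mul_le_mul (he2.trans hr1) he2 he2' zero_le_one
      _ = r := one_mul r
  have h1 : |d20 * e ^ 2| ≤ |d20| * r := by rw [abs_mul, abs_of_nonneg he2']; exact mul_le_mul_of_nonneg_left he2 (abs_nonneg _)
  have h2 : |d01 * lam| ≤ |d01| * δ := by
    rw [abs_mul, abs_of_nonneg hlam0]; exact mul_le_mul_of_nonneg_left hlamδ (abs_nonneg _)
  have h3 : |d21 * (e ^ 2 * lam)| ≤ |d21| * r := by
    rw [abs_mul, abs_of_nonneg (mul_nonneg he2' hlam0)]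
    refine mul_le_mul_of_nonneg_left ?_ (abs_nonneg _)
    calc e ^ 2 * lam ≤ r * 1 := mul_le_mul he2 hlam1 hlam0 hr0.le
      _ = r := mul_one r
  have h4 : |d40 * e ^ 4| ≤ |d40| * r := by
    rw [abs_mul, abs_of_nonneg (by positivity : (0 : ℝ) ≤ e ^ 4)]; exact mul_le_mul_of_nonneg_left he4 (abs_nonneg _)
  have hKr : K * r ≤ m2 / 4 := by
    calc K * r ≤ K * (m2 / (4 * K + 4)) := mul_le_mul_of_nonneg_left hr2 hK0
      _ ≤ m2 / 4 := by
          rw [mul_div_assoc']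
          rw [div_le_div_iff₀ (by positivity) (by norm_num : (0 : ℝ) < 4)]
          nlinarith
  have hdδ : |d01| * δ ≤ m2 / 4 := by
    calc |d01| * δ ≤ |d01| * (m2 / (4 * |d01| + 4)) := mul_le_mul_of_nonneg_left hδ2 (abs_nonneg _)
      _ ≤ m2 / 4 := by
          rw [mul_div_assoc']
          rw [div_le_div_iff₀ (by positivity) (by norm_num : (0 : ℝ) < 4)]
          nlinarith [abs_nonneg d01]
  calc |d20 * e ^ 2 + d01 * lam + d21 * (e ^ 2 * lam) + d40 * e ^ 4|
      ≤ |d20 * e ^ 2| + |d01 * lam| + |d21 * (e ^ 2 * lam)| + |d40 * e ^ 4| := by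
        refine (abs_add_le _ _).trans (add_le_add ((abs_add_le _ _).trans (add_le_add (abs_add_le _ _) le_rfl)) le_rfl)
    _ ≤ |d20| * r + |d01| * δ + |d21| * r + |d40| * r := by linarith
    _ = K * r + |d01| * δ := by rw [hK]; ring
    _ ≤ m2 / 2 := by linarith

/-- **the running mass `m² + ct(e,λ)` is positive on the slab** (indeed `≥ m²/2`). [cite: Balaban1983Higgs3, (1.20) p.416, (1.23) p.417] -/
theorem poly_slab_pos {m2 : ℝ} (hm : 0 < m2) (d20 d01 d21 d40 : ℝ) :
    ∀ p ∈ Ioo (-(min 1 (m2 / (4 * (|d20| + |d21| + |d40|) + 4)))) (min 1 (m2 / (4 * (|d20| + |d21| + |d40|) + 4)))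
        ×ˢ Icc 0 (min 1 (m2 / (4 * |d01| + 4))),
      0 < m2 + (fun (u l : ℝ) => d20 * u ^ 2 + d01 * l + d21 * (u ^ 2 * l) + d40 * u ^ 4) p.1 p.2 := by
  intro p hp
  have h := abs_poly_le hm d20 d01 d21 d40 (mem_prod.1 hp).1 (mem_prod.1 hp).2
  have h' := (abs_le.1 h).1
  dsimp only
  linarith

/-- `δ = min 1 (m²/(4∣d01∣+4)) > 0`. [cite: Balaban1983Higgs3, (1.23) p.417] -/
theorem delta_pos {m2 : ℝ} (hm : 0 < m2) (d01 : ℝ) : 0 < min 1 (m2 / (4 * |d01| + 4)) :=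
  lt_min one_pos (div_pos hm (by positivity))

/-- `r = min 1 (m²/(4K+4)) > 0`. [cite: Balaban1983Higgs3, (1.23) p.417] -/
theorem radius_pos {m2 : ℝ} (hm : 0 < m2) (d20 d21 d40 : ℝ) :
    0 < min 1 (m2 / (4 * (|d20| + |d21| + |d40|) + 4)) :=
  lt_min one_pos (div_pos hm (by positivity))

/-- **locality of the one-sided derivatives at `λ = 0`**: `∂^β_{λ,[0,∞)}f(0) = ∂^β_{λ,[0,δ]}f(0)` for every `f : ℝ → ℝ` and `δ > 0`
(the two constraint sets agree near `0`). (folklore, Mathlib-level: `iteratedFDerivWithin_congr_set`)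
[cite: Balaban1983Higgs3, (1.23) p.417] -/
theorem iteratedDerivWithin_Ici_eq_Icc_zero (f : ℝ → ℝ) {δ : ℝ} (hδ : 0 < δ) (β : ℕ) :
    iteratedDerivWithin β f (Ici 0) 0 = iteratedDerivWithin β f (Icc 0 δ) 0 := by
  have h : Ici (0 : ℝ) =ᶠ[𝓝 0] Icc 0 δ := by
    filter_upwards [Iio_mem_nhds hδ] with s hs
    simp only [eq_iff_iff]
    exact ⟨fun h => ⟨h, (mem_Iio.1 hs).le⟩, fun h => h.1⟩
  rw [iteratedDerivWithin_eq_iteratedFDerivWithin, iteratedDerivWithin_eq_iteratedFDerivWithin, iteratedFDerivWithin_congr_set h]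

/-- `0 ∈ closure (interior [0, δ])` for `δ > 0`. (folklore) [cite: Balaban1983Higgs3, (1.23) p.417] -/
theorem zero_mem_closure_interior_Icc {δ : ℝ} (hδ : 0 < δ) : (0 : ℝ) ∈ closure (interior (Icc (0 : ℝ) δ)) := by
  rw [interior_Icc, closure_Ioo hδ.ne]
  exact ⟨le_rfl, hδ.le⟩

end Slab

/-! ## §3 SCHWARZ FOR THE POLYNOMIAL COUNTERTERM: the iterated mixed partials of `G^{ct}` at `(e₀, 0⁺)` do not depend on the order,
for every index `(α,β)` -/

section Comm

/-- **`G^{ct}` is jointly `C^n` on the slab `(−r,r) ×ˢ [0,δ]`** for the polynomial counterterm (BRICK 11 `contDiffOn_twoPtCt`, the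
running mass positive there by §2), every `n`. [cite: Balaban1983Higgs3, (1.19)–(1.21) p.416, (1.23) p.417] -/
theorem contDiffOn_twoPtCt_poly (hw : 0 < w) (hm : 0 < m2) (hμ : 0 < μ2) (d20 d01 d21 d40 : ℝ) (a b : Fin N)
    (x x' : Site P j) {n : ℕ∞} :
    ContDiffOn ℝ n (fun p : ℝ × ℝ =>
        twoPtCt C η w c m2 μ2 (fun u l => d20 * u ^ 2 + d01 * l + d21 * (u ^ 2 * l) + d40 * u ^ 4) p a b x x')
      ((Ioo (-(min 1 (m2 / (4 * (|d20| + |d21| + |d40|) + 4)))) (min 1 (m2 / (4 * (|d20| + |d21| + |d40|) + 4))))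
        ×ˢ Icc 0 (min 1 (m2 / (4 * |d01| + 4)))) :=
  contDiffOn_twoPtCt C η w c m2 μ2 hw hμ (convex_Ioo _ _) (convex_Icc _ _) (fun _ hs => hs.1)
    (contDiff_poly d20 d01 d21 d40) (poly_slab_pos hm d20 d01 d21 d40) a b x x'

/-- **SCHWARZ AT A BASE CHARGE `∣e₀∣ < r`: `∂^α_e[∂^β_{λ,+}G^{ct}(e,·)(0)]∣_{e₀} = ∂^β_{λ,+}[∂^α_eG^{ct}(·,λ)∣_{e₀}](0⁺)`**, both
`λ`-derivatives one-sided within `[0,∞)` at `0`, for the polynomial counterterm of (1.23), every `(α,β)`, every real letters.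
[cite: Balaban1983Higgs3, (1.19)–(1.21) p.416, (1.23) p.417] [cite: Coleman2012, §4.1 Thm. 4.3] -/
theorem iteratedDeriv_iteratedDerivWithin_comm_poly_at (hw : 0 < w) (hm : 0 < m2) (hμ : 0 < μ2) (d20 d01 d21 d40 : ℝ)
    (a b : Fin N) (x x' : Site P j) (α β : ℕ) {e₀ : ℝ}
    (he₀ : e₀ ∈ Ioo (-(min 1 (m2 / (4 * (|d20| + |d21| + |d40|) + 4)))) (min 1 (m2 / (4 * (|d20| + |d21| + |d40|) + 4)))) :
    iteratedDeriv α (fun e => iteratedDerivWithin β (fun s =>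
        twoPtCt C η w c m2 μ2 (fun u l => d20 * u ^ 2 + d01 * l + d21 * (u ^ 2 * l) + d40 * u ^ 4) (e, s) a b x x')
          (Ici 0) 0) e₀
      = iteratedDerivWithin β (fun s => iteratedDeriv α (fun e =>
          twoPtCt C η w c m2 μ2 (fun u l => d20 * u ^ 2 + d01 * l + d21 * (u ^ 2 * l) + d40 * u ^ 4) (e, s) a b x x') e₀)
          (Ici 0) 0 := by
  set δ : ℝ := min 1 (m2 / (4 * |d01| + 4)) with hδdef
  have hδ : 0 < δ := delta_pos hm d01
  -- pass from `[0, ∞)` to `[0, δ]` on both sides (locality at `λ = 0`)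
  have hL : (fun e => iteratedDerivWithin β (fun s =>
        twoPtCt C η w c m2 μ2 (fun u l => d20 * u ^ 2 + d01 * l + d21 * (u ^ 2 * l) + d40 * u ^ 4) (e, s) a b x x')
          (Ici 0) 0)
      = fun e => iteratedDerivWithin β (fun s =>
        twoPtCt C η w c m2 μ2 (fun u l => d20 * u ^ 2 + d01 * l + d21 * (u ^ 2 * l) + d40 * u ^ 4) (e, s) a b x x')
          (Icc 0 δ) 0 := by
    funext e
    exact iteratedDerivWithin_Ici_eq_Icc_zero _ hδ β
  rw [hL, iteratedDerivWithin_Ici_eq_Icc_zero _ hδ β]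
  have hαβ : ((α + β : ℕ) : ℕ∞) ≤ (⊤ : ℕ∞) := le_top
  exact iteratedDeriv_iteratedDerivWithin_twoPtCt_comm C η w c m2 μ2 hw hμ isOpen_Ioo (convex_Ioo _ _) (convex_Icc _ _)
    (uniqueDiffOn_Icc hδ) (fun _ hs => hs.1) (contDiff_poly d20 d01 d21 d40) (poly_slab_pos hm d20 d01 d21 d40) a b x x'
    hαβ he₀ ⟨le_rfl, hδ.le⟩ (zero_mem_closure_interior_Icc hδ)

/-- **SCHWARZ AT `(0, 0⁺)`, EVERY INDEX `(α,β)`: `∂^α_e[∂^β_{λ,+}G^{ct}(e,·)(0)]∣₀ = ∂^β_{λ,+}[∂^α_eG^{ct}(·,λ)∣₀](0⁺)`** — the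
«`λ` first» coefficients of BRICK 11's Taylor formula `twoPtCt_taylor` and the «`e` first» data of BRICKS 10/14 are the same
numbers, for the polynomial counterterm `δm²_{(2,0)}e² + δm²_{(0,1)}λ + δm²_{(2,1)}e²λ + δm²_{(4,0)}e⁴` of (1.23) with ANY real letters.
[cite: Balaban1983Higgs3, (1.19)–(1.21) p.416, (1.23) p.417] [cite: Coleman2012, §4.1 Thm. 4.3] -/
theorem iteratedDeriv_iteratedDerivWithin_comm_poly (hw : 0 < w) (hm : 0 < m2) (hμ : 0 < μ2) (d20 d01 d21 d40 : ℝ)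
    (a b : Fin N) (x x' : Site P j) (α β : ℕ) :
    iteratedDeriv α (fun e => iteratedDerivWithin β (fun s =>
        twoPtCt C η w c m2 μ2 (fun u l => d20 * u ^ 2 + d01 * l + d21 * (u ^ 2 * l) + d40 * u ^ 4) (e, s) a b x x')
          (Ici 0) 0) 0
      = iteratedDerivWithin β (fun s => iteratedDeriv α (fun e =>
          twoPtCt C η w c m2 μ2 (fun u l => d20 * u ^ 2 + d01 * l + d21 * (u ^ 2 * l) + d40 * u ^ 4) (e, s) a b x x') 0)
          (Ici 0) 0 :=
  iteratedDeriv_iteratedDerivWithin_comm_poly_at C η w c m2 μ2 hw hm hμ d20 d01 d21 d40 a b x x' α β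
    (mem_Ioo.2 ⟨neg_lt_zero.2 (radius_pos hm d20 d21 d40), radius_pos hm d20 d21 d40⟩)

end Comm

/-! ## §4 THE INDEX `(2,1)`: BRICK 14's «`e` first» datum is the «`λ` first» coefficient; the closed form and print's equation in
the «`λ` first» reading -/

section IndexTwoOne

/-- **THE TWO ORDERS AGREE AT `(2,1)`: `∂²_e[∂_λ⁺G^{ct}_{ab}(x,x′)(e,·)(0)]∣₀ = ∂_λ⁺[∂²_eG^{ct}_{ab}(x,x′)(·,λ)∣₀](0⁺)`**, the
right-hand side being BRICK 14's datum verbatim (`derivWithin (λ ↦ iteratedDeriv 2 (e ↦ G^{ct}(e,λ)) 0) (Set.Ici 0) 0`, the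
two-point function written out as BRICK 14 writes it); any real `d20 d01 d21 d40`. [cite: Balaban1983Higgs3, (1.19)–(1.21) p.416, (1.23) p.417]
[cite: Coleman2012, §4.1 Thm. 4.3] -/
theorem index21_orders_agree (hw : 0 < w) (hm : 0 < m2) (hμ : 0 < μ2) (d20 d01 d21 d40 : ℝ) (a b : Fin N)
    (x x' : Site P j) :
    iteratedDeriv 2 (fun e : ℝ => derivWithin (fun lam : ℝ =>
        (∫ p : JCfg P j N, J C η w c (m2 + (d20 * e ^ 2 + d01 * lam + d21 * (e ^ 2 * lam) + d40 * e ^ 4)) μ2 e p *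
            (Real.exp (-(lam * ∑ y : Site P j, w * ‖p.2 y‖ ^ 4)) * legs a b x x' p.2)) /
          ∫ p : JCfg P j N, J C η w c (m2 + (d20 * e ^ 2 + d01 * lam + d21 * (e ^ 2 * lam) + d40 * e ^ 4)) μ2 e p *
            Real.exp (-(lam * ∑ y : Site P j, w * ‖p.2 y‖ ^ 4))) (Ici 0) 0) 0
      = derivWithin (fun lam : ℝ => iteratedDeriv 2 (fun e : ℝ =>
        (∫ p : JCfg P j N, J C η w c (m2 + (d20 * e ^ 2 + d01 * lam + d21 * (e ^ 2 * lam) + d40 * e ^ 4)) μ2 e p *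
            (Real.exp (-(lam * ∑ y : Site P j, w * ‖p.2 y‖ ^ 4)) * legs a b x x' p.2)) /
          ∫ p : JCfg P j N, J C η w c (m2 + (d20 * e ^ 2 + d01 * lam + d21 * (e ^ 2 * lam) + d40 * e ^ 4)) μ2 e p *
            Real.exp (-(lam * ∑ y : Site P j, w * ‖p.2 y‖ ^ 4))) 0) (Ici 0) 0 := by
  have h := iteratedDeriv_iteratedDerivWithin_comm_poly C η w c m2 μ2 hw hm hμ d20 d01 d21 d40 a b x x' 2 1
  simp only [iteratedDerivWithin_one, twoPtCt_poly_eq] at h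
  exact h

/-- **THE «`λ` FIRST» `(2,1)` DATUM IN CLOSED FORM at print's `δm²_{(0,1)} = −4(N+2)C^ε_0(0)`** — BRICK 14
`derivWithin_index21_explicit`'s right-hand side verbatim: **`∂²_e[∂_λ⁺G^{ct}_{ab}(x,x′)(e,·)(0)]∣₀ = −Σ_yη^d·8C₀(x,y)C₀(x′,y)·
{[δ_{ab}tr q² + 2(q²)_{ab}]·[Σ_bη^dc²η²C^ε(b₋,b₋)C₀(b₋,y)C₀(b₊,y) + Σ_{b,b′:μ=μ′}(η^dc²η)²C^ε(b₋,b′₋)Bk(b,b′;y,y)] −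
δm²_{(2,0)}(N+2)δ_{ab}Σ_zη^dC₀(z,y)²} − 2δm²_{(2,1)}δ_{ab}Σ_zη^dC₀(x,z)C₀(x′,z)`** — `2!1!` times the `e²λ` coefficient of BRICK 11's
two-variable Taylor formula of (1.19) at `(0,0⁺)`: the Wick-ordered quartic vertex with the order-`e²` loop insertion (② + ④)
minus its `δm²_{(2,0)}` bubble, and `C₀(−δm²_{(2,1)})C₀`. [cite: Balaban1983Higgs3, (1.19)–(1.23) pp.416–417]
[cite: GlimmJaffeQP1987, Cor. 8.3.2, §8.4–8.5] -/
theorem iteratedDeriv_two_derivWithin_explicit (hw : 0 < w) (hm : 0 < m2) (hμ : 0 < μ2) (d20 d01 d21 d40 : ℝ)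
    (hd01 : d01 = -(4 * (N + 2) * C0 (P := P) (j := j) w c m2)) (a b : Fin N) (x x' : Site P j) :
    iteratedDeriv 2 (fun e : ℝ => derivWithin (fun lam : ℝ =>
        (∫ p : JCfg P j N, J C η w c (m2 + (d20 * e ^ 2 + d01 * lam + d21 * (e ^ 2 * lam) + d40 * e ^ 4)) μ2 e p *
            (Real.exp (-(lam * ∑ y : Site P j, w * ‖p.2 y‖ ^ 4)) * legs a b x x' p.2)) /
          ∫ p : JCfg P j N, J C η w c (m2 + (d20 * e ^ 2 + d01 * lam + d21 * (e ^ 2 * lam) + d40 * e ^ 4)) μ2 e p *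
            Real.exp (-(lam * ∑ y : Site P j, w * ‖p.2 y‖ ^ 4))) (Ici 0) 0) 0 =
      -(∑ y : Site P j, w *
          ((∑ l : PBond P j, w * (c ^ 2 * η ^ 2) * G w c μ2 l.src l.src *
              (8 * (G w c m2 x y * G w c m2 x' y * (G w c m2 l.src y * G w c m2 l.tgt y)) *
                (⟪EuclideanSpace.basisFun (Fin N) ℝ a, EuclideanSpace.basisFun (Fin N) ℝ b⟫_ℝ * trE (C.q.comp C.q)
                  + 2 * ⟪EuclideanSpace.basisFun (Fin N) ℝ a, C.q (C.q (EuclideanSpace.basisFun (Fin N) ℝ b))⟫_ℝ)))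
          + (∑ l : PBond P j, ∑ l' : PBond P j, (w * (c ^ 2 * η)) * (w * (c ^ 2 * η)) *
              (G w c μ2 l.src l'.src * if l.dir = l'.dir then 1 else 0) *
                (8 * (G w c m2 x y * G w c m2 x' y) * Bk w c m2 l l' y y *
                  (⟪EuclideanSpace.basisFun (Fin N) ℝ a, EuclideanSpace.basisFun (Fin N) ℝ b⟫_ℝ * trE (C.q.comp C.q)
                    + 2 * ⟪EuclideanSpace.basisFun (Fin N) ℝ a, C.q (C.q (EuclideanSpace.basisFun (Fin N) ℝ b))⟫_ℝ)))
          - d20 * ∑ z : Site P j, w *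
              (8 * (G w c m2 x y * G w c m2 x' y * (G w c m2 z y * G w c m2 z y)) *
                ((N + 2) * ⟪EuclideanSpace.basisFun (Fin N) ℝ a, EuclideanSpace.basisFun (Fin N) ℝ b⟫_ℝ))))
      - d21 * (⟪EuclideanSpace.basisFun (Fin N) ℝ a, EuclideanSpace.basisFun (Fin N) ℝ b⟫_ℝ *
          (2 * ∑ z : Site P j, w * (G w c m2 x z * G w c m2 x' z))) := by
  rw [index21_orders_agree C η w c m2 μ2 hw hm hμ d20 d01 d21 d40 a b x x']
  exact derivWithin_index21_explicit C η w c m2 μ2 hw hm hμ d20 d01 d21 d40 hd01 a b x x'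

/-- **`(2!1!)⁻¹` × THE «`λ` FIRST» DATUM AS THE LOCAL INSERTION `C₀[K − δm²_{(2,1)}]C₀`** (charge matrix with `q² = q2·1`,
print's `δm²_{(0,1)}`): `½∂²_e[∂_λ⁺G^{ct}_{ab}(x,x′)(e,·)(0)]∣₀ = δ_{ab}Σ_yη^dC₀(x,y)[K(y) − δm²_{(2,1)}]C₀(y,x′)` with BRICK 14's
local kernel `K(y) = −4(N+2)·[q2·(Σ_bη^dc²η²C^ε(b₋,b₋)C₀(b₋,y)C₀(b₊,y) + Σ_{b,b′:μ=μ′}(η^dc²η)²C^ε(b₋,b′₋)Bk(b,b′;y,y)) −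
δm²_{(2,0)}Σ_zη^dC₀(z,y)²]` — BRICK 14 `index21_eq_local_insertion` transported across the order of differentiation; print's
equation *"−δm²_{(2,1)} + Σ_{x∈T_ε}ε^dΣ^ε_{(2,1)}(x) = 0"* for this kernel is BRICK 14 `condition_21_iff` (`⟺ δm²_{(2,1)} = K(x)`).
[cite: Balaban1983Higgs3, (1.21) p.416, (1.23) p.417] -/
theorem index21_lamFirst_eq_local_insertion (hw : 0 < w) (hm : 0 < m2) (hμ : 0 < μ2) (d20 d01 d21 d40 q2 : ℝ)
    (hd01 : d01 = -(4 * (N + 2) * C0 (P := P) (j := j) w c m2)) (hq2 : ∀ v : EuclideanSpace ℝ (Fin N), C.q (C.q v) = q2 • v)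
    {K : Site P j → ℝ}
    (hK : ∀ y, K y = -(4 * (N + 2)) * (q2 * ((∑ l : PBond P j, w * (c ^ 2 * η ^ 2) * G w c μ2 l.src l.src *
        (G w c m2 l.src y * G w c m2 l.tgt y))
        + ∑ l : PBond P j, ∑ l' : PBond P j, (w * (c ^ 2 * η)) * (w * (c ^ 2 * η)) *
          (G w c μ2 l.src l'.src * if l.dir = l'.dir then 1 else 0) * Bk w c m2 l l' y y)
        - d20 * ∑ z : Site P j, w * G w c m2 z y ^ 2))
    (a b : Fin N) (x x' : Site P j) :
    (1 / 2 : ℝ) * iteratedDeriv 2 (fun e : ℝ => derivWithin (fun lam : ℝ =>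
        (∫ p : JCfg P j N, J C η w c (m2 + (d20 * e ^ 2 + d01 * lam + d21 * (e ^ 2 * lam) + d40 * e ^ 4)) μ2 e p *
            (Real.exp (-(lam * ∑ y : Site P j, w * ‖p.2 y‖ ^ 4)) * legs a b x x' p.2)) /
          ∫ p : JCfg P j N, J C η w c (m2 + (d20 * e ^ 2 + d01 * lam + d21 * (e ^ 2 * lam) + d40 * e ^ 4)) μ2 e p *
            Real.exp (-(lam * ∑ y : Site P j, w * ‖p.2 y‖ ^ 4))) (Ici 0) 0) 0 =
      ⟪EuclideanSpace.basisFun (Fin N) ℝ a, EuclideanSpace.basisFun (Fin N) ℝ b⟫_ℝ *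
        ∑ y : Site P j, w * (G w c m2 x y * (K y - d21) * G w c m2 y x') := by
  rw [index21_orders_agree C η w c m2 μ2 hw hm hμ d20 d01 d21 d40 a b x x']
  exact index21_eq_local_insertion C η w c m2 μ2 hw hm hμ d20 d01 d21 d40 q2 hd01 hq2 hK a b x x'

/-- **THE `(2,1)` COEFFICIENT OF BRICK 11's TWO-VARIABLE TAYLOR FORMULA ON THE SLAB IS BRICK 14's DATUM**: with the inner
one-sided derivative taken within `[0, δ]` (the `Λ` of `twoPtCt_taylor` for the slab of §2 — `I = (−r, r)`, `Λ = [0, δ]`,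
`0 ∈ Λ ∩ closure (interior Λ)`), `∂²_e[∂_{λ,[0,δ]}G^{ct}(e,·)(0)]∣₀ = ∂_λ⁺[∂²_eG^{ct}(·,λ)∣₀](0⁺)`; so in `twoPtCt_taylor` (order
`k ≥ 3`, the polynomial counterterm, this slab) the term `(α, i−α) = (2,1)` reads `(2!1!)⁻¹e²λ × [BRICK 14's closed form]`.
[cite: Balaban1983Higgs3, (1.19)–(1.21) p.416, (1.23) p.417] [cite: Coleman2012, §4.1 Thm. 4.3, §5.1 Thm. 5.3] -/
theorem taylorCoeff21_slab_eq_index21 (hw : 0 < w) (hm : 0 < m2) (hμ : 0 < μ2) (d20 d01 d21 d40 : ℝ) (a b : Fin N)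
    (x x' : Site P j) :
    iteratedDeriv 2 (fun u : ℝ => iteratedDerivWithin 1 (fun s : ℝ =>
        twoPtCt C η w c m2 μ2 (fun u l => d20 * u ^ 2 + d01 * l + d21 * (u ^ 2 * l) + d40 * u ^ 4) (u, s) a b x x')
          (Icc 0 (min 1 (m2 / (4 * |d01| + 4)))) 0) 0
      = derivWithin (fun lam : ℝ => iteratedDeriv 2 (fun e : ℝ =>
        (∫ p : JCfg P j N, J C η w c (m2 + (d20 * e ^ 2 + d01 * lam + d21 * (e ^ 2 * lam) + d40 * e ^ 4)) μ2 e p *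
            (Real.exp (-(lam * ∑ y : Site P j, w * ‖p.2 y‖ ^ 4)) * legs a b x x' p.2)) /
          ∫ p : JCfg P j N, J C η w c (m2 + (d20 * e ^ 2 + d01 * lam + d21 * (e ^ 2 * lam) + d40 * e ^ 4)) μ2 e p *
            Real.exp (-(lam * ∑ y : Site P j, w * ‖p.2 y‖ ^ 4))) 0) (Ici 0) 0 := by
  rw [← index21_orders_agree C η w c m2 μ2 hw hm hμ d20 d01 d21 d40 a b x x']
  congr 1
  funext u
  rw [← iteratedDerivWithin_Ici_eq_Icc_zero _ (delta_pos hm d01) 1, iteratedDerivWithin_one]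
  simp only [twoPtCt_poly_eq]

end IndexTwoOne

/-! ## §5 THE VACUUM SIDE: the same order-independence for `log Z^{ct}(e,λ)` with BRICK 17's six-letter counterterm polynomial
`δm²_{(2,0)}e² + δm²_{(0,1)}λ + δm²_{(2,1)}e²λ + δm²_{(0,2)}λ² + δm²_{(2,2)}e²λ² + δm²_{(4,0)}e⁴` inserted — every index `(α,β)` of (1.24)'s
vacuum energy `E₁` (p. 418: `2 ≤ α+2β ≤ 6`) in the `E1of124R` order («λ first», BRICKS 16/17) equals the «e first» iterated partial
(BRICK 13's order): `log∫fibre` is jointly `C^∞` on the slab (BRICK 11 `contDiffOn_integral_fibre` with `F = 1`, positivity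
`integral_fibre_one_pos`, `ContDiffOn.log`) and the generic Schwarz-within-the-slab of `Literature.Analysis.Calculus.MixedPartialDerivWithin`
§6 (`iteratedDeriv_iteratedDerivWithin_comm_openFst`, this seat at the typer's request) applies -/

section Vacuum

omit C η w c m2 μ2 in
/-- the six-letter counterterm polynomial is jointly `C^n` in `(e,λ)`, every `n`. [cite: Balaban1983Higgs3, (1.23)–(1.24) p.417] -/
theorem contDiff_poly6 (d20 d01 d21 d02 d22 d40 : ℝ) {n : WithTop ℕ∞} :
    ContDiff ℝ n (fun p : ℝ × ℝ =>
      d20 * p.1 ^ 2 + d01 * p.2 + d21 * (p.1 ^ 2 * p.2) + d02 * p.2 ^ 2 + d22 * (p.1 ^ 2 * p.2 ^ 2) + d40 * p.1 ^ 4) :=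
  (((((contDiff_const.mul (contDiff_fst.pow 2)).add (contDiff_const.mul contDiff_snd)).add
    (contDiff_const.mul ((contDiff_fst.pow 2).mul contDiff_snd))).add (contDiff_const.mul (contDiff_snd.pow 2))).add
    (contDiff_const.mul ((contDiff_fst.pow 2).mul (contDiff_snd.pow 2)))).add (contDiff_const.mul (contDiff_fst.pow 4))

omit C η w c m2 μ2 in
/-- **`∣δm²(e,λ)∣ ≤ m²/2` on the slab** for the six-letter polynomial: `∣e∣ < r₆ = min 1 (m²/(4K+4))`, `K = ∣d20∣+∣d21∣+∣d22∣+∣d40∣`,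
`0 ≤ λ ≤ δ₆ = min 1 (m²/(4(∣d01∣+∣d02∣)+4))`. [cite: Balaban1983Higgs3, (1.20) p.416, (1.23)–(1.24) p.417] -/
theorem abs_poly6_le {m2 : ℝ} (hm : 0 < m2) (d20 d01 d21 d02 d22 d40 : ℝ) {e lam : ℝ}
    (he : e ∈ Ioo (-(min 1 (m2 / (4 * (|d20| + |d21| + |d22| + |d40|) + 4))))
      (min 1 (m2 / (4 * (|d20| + |d21| + |d22| + |d40|) + 4))))
    (hlam : lam ∈ Icc 0 (min 1 (m2 / (4 * (|d01| + |d02|) + 4)))) :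
    |d20 * e ^ 2 + d01 * lam + d21 * (e ^ 2 * lam) + d02 * lam ^ 2 + d22 * (e ^ 2 * lam ^ 2) + d40 * e ^ 4| ≤ m2 / 2 := by
  set K : ℝ := |d20| + |d21| + |d22| + |d40| with hK
  set K' : ℝ := |d01| + |d02| with hK'
  have hK0 : 0 ≤ K := by positivity
  have hK'0 : 0 ≤ K' := by positivity
  set r : ℝ := min 1 (m2 / (4 * K + 4)) with hr
  set δ : ℝ := min 1 (m2 / (4 * K' + 4)) with hδ
  have hr1 : r ≤ 1 := min_le_left _ _
  have hr2 : r ≤ m2 / (4 * K + 4) := min_le_right _ _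
  have hδ1 : δ ≤ 1 := min_le_left _ _
  have hδ2 : δ ≤ m2 / (4 * K' + 4) := min_le_right _ _
  have hr0 : 0 < r := lt_min one_pos (div_pos hm (by positivity))
  have hδ0 : 0 < δ := lt_min one_pos (div_pos hm (by positivity))
  have he' : |e| < r := abs_lt.2 he
  have he1 : |e| ≤ 1 := he'.le.trans hr1
  have hlam0 : 0 ≤ lam := hlam.1
  have hlamδ : lam ≤ δ := hlam.2
  have hlam1 : lam ≤ 1 := hlamδ.trans hδ1
  have he2' : 0 ≤ e ^ 2 := sq_nonneg e
  have he2 : e ^ 2 ≤ r := by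
    have : e ^ 2 = |e| * |e| := by rw [abs_mul_abs_self]; ring
    rw [this]
    calc |e| * |e| ≤ 1 * r := mul_le_mul he1 he'.le (abs_nonneg _) zero_le_one
      _ = r := one_mul r
  have he4 : e ^ 4 ≤ r := by
    have : e ^ 4 = e ^ 2 * e ^ 2 := by ring
    rw [this]
    calc e ^ 2 * e ^ 2 ≤ 1 * r := mul_le_mul (he2.trans hr1) he2 he2' zero_le_one
      _ = r := one_mul r
  have hl2 : lam ^ 2 ≤ δ := by
    calc lam ^ 2 = lam * lam := sq lam
      _ ≤ 1 * δ := mul_le_mul hlam1 hlamδ hlam0 zero_le_one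
      _ = δ := one_mul δ
  have hl2' : 0 ≤ lam ^ 2 := sq_nonneg lam
  have h1 : |d20 * e ^ 2| ≤ |d20| * r := by
    rw [abs_mul, abs_of_nonneg he2']; exact mul_le_mul_of_nonneg_left he2 (abs_nonneg _)
  have h2 : |d01 * lam| ≤ |d01| * δ := by
    rw [abs_mul, abs_of_nonneg hlam0]; exact mul_le_mul_of_nonneg_left hlamδ (abs_nonneg _)
  have h3 : |d21 * (e ^ 2 * lam)| ≤ |d21| * r := by
    rw [abs_mul, abs_of_nonneg (mul_nonneg he2' hlam0)]
    refine mul_le_mul_of_nonneg_left ?_ (abs_nonneg _)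
    calc e ^ 2 * lam ≤ r * 1 := mul_le_mul he2 hlam1 hlam0 hr0.le
      _ = r := mul_one r
  have h4 : |d02 * lam ^ 2| ≤ |d02| * δ := by
    rw [abs_mul, abs_of_nonneg hl2']; exact mul_le_mul_of_nonneg_left hl2 (abs_nonneg _)
  have h5 : |d22 * (e ^ 2 * lam ^ 2)| ≤ |d22| * r := by
    rw [abs_mul, abs_of_nonneg (mul_nonneg he2' hl2')]
    refine mul_le_mul_of_nonneg_left ?_ (abs_nonneg _)
    calc e ^ 2 * lam ^ 2 ≤ r * 1 := mul_le_mul he2 (hl2.trans hδ1) hl2' hr0.le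
      _ = r := mul_one r
  have h6 : |d40 * e ^ 4| ≤ |d40| * r := by
    rw [abs_mul, abs_of_nonneg (by positivity : (0 : ℝ) ≤ e ^ 4)]; exact mul_le_mul_of_nonneg_left he4 (abs_nonneg _)
  have hKr : K * r ≤ m2 / 4 := by
    calc K * r ≤ K * (m2 / (4 * K + 4)) := mul_le_mul_of_nonneg_left hr2 hK0
      _ ≤ m2 / 4 := by
          rw [mul_div_assoc']
          rw [div_le_div_iff₀ (by positivity) (by norm_num : (0 : ℝ) < 4)]
          nlinarith
  have hK'δ : K' * δ ≤ m2 / 4 := by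
    calc K' * δ ≤ K' * (m2 / (4 * K' + 4)) := mul_le_mul_of_nonneg_left hδ2 hK'0
      _ ≤ m2 / 4 := by
          rw [mul_div_assoc']
          rw [div_le_div_iff₀ (by positivity) (by norm_num : (0 : ℝ) < 4)]
          nlinarith
  calc |d20 * e ^ 2 + d01 * lam + d21 * (e ^ 2 * lam) + d02 * lam ^ 2 + d22 * (e ^ 2 * lam ^ 2) + d40 * e ^ 4|
      ≤ |d20 * e ^ 2| + |d01 * lam| + |d21 * (e ^ 2 * lam)| + |d02 * lam ^ 2| + |d22 * (e ^ 2 * lam ^ 2)|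
          + |d40 * e ^ 4| := by
        refine (abs_add_le _ _).trans (add_le_add ((abs_add_le _ _).trans (add_le_add ((abs_add_le _ _).trans
          (add_le_add ((abs_add_le _ _).trans (add_le_add (abs_add_le _ _) le_rfl)) le_rfl)) le_rfl)) le_rfl)
    _ ≤ |d20| * r + |d01| * δ + |d21| * r + |d02| * δ + |d22| * r + |d40| * r := by linarith
    _ = K * r + K' * δ := by rw [hK, hK']; ring
    _ ≤ m2 / 2 := by linarith

omit C η w c m2 μ2 in
/-- **the running mass is positive on the six-letter slab**. [cite: Balaban1983Higgs3, (1.20) p.416, (1.23)–(1.24) p.417] -/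
theorem poly6_slab_pos {m2 : ℝ} (hm : 0 < m2) (d20 d01 d21 d02 d22 d40 : ℝ) :
    ∀ p ∈ Ioo (-(min 1 (m2 / (4 * (|d20| + |d21| + |d22| + |d40|) + 4)))) (min 1 (m2 / (4 * (|d20| + |d21| + |d22| + |d40|) + 4)))
        ×ˢ Icc 0 (min 1 (m2 / (4 * (|d01| + |d02|) + 4))),
      0 < m2 + (fun (u l : ℝ) =>
        d20 * u ^ 2 + d01 * l + d21 * (u ^ 2 * l) + d02 * l ^ 2 + d22 * (u ^ 2 * l ^ 2) + d40 * u ^ 4) p.1 p.2 := by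
  intro p hp
  have h := abs_poly6_le hm d20 d01 d21 d02 d22 d40 (mem_prod.1 hp).1 (mem_prod.1 hp).2
  have h' := (abs_le.1 h).1
  dsimp only
  linarith

/-- **`log Z^{ct}(e,λ)` WITH THE SIX-LETTER POLYNOMIAL INSERTED IS JOINTLY `C^n` ON THE SLAB** (BRICK 11's `∫fibre ct 1` is the
partition function with counterterm and quartic coupling; it is positive and jointly `C^n`; `log` of it). [cite: Balaban1983Higgs3,
(1.20) p.416, (1.24) p.417] -/
theorem contDiffOn_logZct_poly6 (hw : 0 < w) (hm : 0 < m2) (hμ : 0 < μ2) (d20 d01 d21 d02 d22 d40 : ℝ) {n : ℕ∞} :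
    ContDiffOn ℝ n (fun p : ℝ × ℝ => Real.log (∫ z : JCfg P j N, fibre C η w c m2 μ2
        (fun u l => d20 * u ^ 2 + d01 * l + d21 * (u ^ 2 * l) + d02 * l ^ 2 + d22 * (u ^ 2 * l ^ 2) + d40 * u ^ 4)
        (fun _ => 1) p z))
      ((Ioo (-(min 1 (m2 / (4 * (|d20| + |d21| + |d22| + |d40|) + 4)))) (min 1 (m2 / (4 * (|d20| + |d21| + |d22| + |d40|) + 4))))
        ×ˢ Icc 0 (min 1 (m2 / (4 * (|d01| + |d02|) + 4)))) := by
  refine (contDiffOn_integral_fibre C η w c m2 μ2 hw hμ (convex_Ioo _ _) (convex_Icc _ _) (fun _ hs => hs.1)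
    (contDiff_poly6 d20 d01 d21 d02 d22 d40) (poly6_slab_pos hm d20 d01 d21 d02 d22 d40) (ExpGrowth.const 1)).log ?_
  intro p hp
  exact (integral_fibre_one_pos C η w c m2 μ2 hw hμ (mem_prod.1 hp).2.1 (poly6_slab_pos hm d20 d01 d21 d02 d22 d40 p hp)).ne'

/-- **SCHWARZ FOR THE VACUUM ENERGY WITH THE COUNTERTERM SERIES INSERTED, EVERY INDEX `(α,β)`**: for BRICK 17's `log Z^{ct}(e,λ) =
log ∫dA dφ J_e(m² + δm²(e,λ)) e^{−λΣη^d∣φ∣⁴}` with the six weight-`≤ 4`-and-bookkeeping letters (any reals),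
`∂^α_e[∂^β_{λ,+} log Z^{ct}(e,·)(0)]∣₀ = ∂^β_{λ,+}[∂^α_e log Z^{ct}(·,λ)∣₀](0⁺)` — the `E1of124R`-order data of BRICKS 16/17 (indices
`(2,1)`, `(2,2)`) and the «e first» data of BRICK 13's order are the same numbers; available as is to a successor taking `(4,0)`,
`(4,1)`, `(6,0)` (the weight-6 letters `δm²_{(4,1)}e⁴λ`, `δm²_{(6,0)}e⁶`, `δm²_{(0,3)}λ³` are NOT in this polynomial: with them
inserted, re-run `contDiff_poly6`/`abs_poly6_le` with the longer polynomial — the only places its shape enters).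
[cite: Balaban1983Higgs3, (1.24) p.417, p.418] [cite: Coleman2012, §4.1 Thm. 4.3] -/
theorem iteratedDeriv_iteratedDerivWithin_logZct_comm_poly6 (hw : 0 < w) (hm : 0 < m2) (hμ : 0 < μ2)
    (d20 d01 d21 d02 d22 d40 : ℝ) (α β : ℕ) :
    iteratedDeriv α (fun e : ℝ => iteratedDerivWithin β (fun lam : ℝ => Real.log (∫ p : JCfg P j N,
        J C η w c (m2 + (d20 * e ^ 2 + d01 * lam + d21 * (e ^ 2 * lam) + d02 * lam ^ 2
          + d22 * (e ^ 2 * lam ^ 2) + d40 * e ^ 4)) μ2 e p *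
          Real.exp (-(lam * ∑ y : Site P j, w * ‖p.2 y‖ ^ 4)))) (Ici 0) 0) 0
      = iteratedDerivWithin β (fun lam : ℝ => iteratedDeriv α (fun e : ℝ => Real.log (∫ p : JCfg P j N,
        J C η w c (m2 + (d20 * e ^ 2 + d01 * lam + d21 * (e ^ 2 * lam) + d02 * lam ^ 2
          + d22 * (e ^ 2 * lam ^ 2) + d40 * e ^ 4)) μ2 e p *
          Real.exp (-(lam * ∑ y : Site P j, w * ‖p.2 y‖ ^ 4)))) 0) (Ici 0) 0 := by
  set δ : ℝ := min 1 (m2 / (4 * (|d01| + |d02|) + 4)) with hδdef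
  have hδ : 0 < δ := lt_min one_pos (div_pos hm (by positivity))
  set r : ℝ := min 1 (m2 / (4 * (|d20| + |d21| + |d22| + |d40|) + 4)) with hrdef
  have hr : 0 < r := lt_min one_pos (div_pos hm (by positivity))
  -- the function is BRICK 11's `log ∫fibre ct 1`
  set Φ : ℝ × ℝ → ℝ := fun p => Real.log (∫ z : JCfg P j N, fibre C η w c m2 μ2
      (fun u l => d20 * u ^ 2 + d01 * l + d21 * (u ^ 2 * l) + d02 * l ^ 2 + d22 * (u ^ 2 * l ^ 2) + d40 * u ^ 4)
      (fun _ => 1) p z) with hΦdef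
  have hΦ : ∀ e lam : ℝ, Real.log (∫ p : JCfg P j N,
        J C η w c (m2 + (d20 * e ^ 2 + d01 * lam + d21 * (e ^ 2 * lam) + d02 * lam ^ 2
          + d22 * (e ^ 2 * lam ^ 2) + d40 * e ^ 4)) μ2 e p *
          Real.exp (-(lam * ∑ y : Site P j, w * ‖p.2 y‖ ^ 4))) = Φ (e, lam) := by
    intro e lam
    simp only [hΦdef, fibre_apply, mul_one]
  simp only [hΦ]
  -- pass from `[0, ∞)` to `[0, δ]` on both sides (locality at `λ = 0`)
  have hL : (fun e => iteratedDerivWithin β (fun s => Φ (e, s)) (Ici 0) 0)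
      = fun e => iteratedDerivWithin β (fun s => Φ (e, s)) (Icc 0 δ) 0 := by
    funext e
    exact iteratedDerivWithin_Ici_eq_Icc_zero _ hδ β
  rw [hL, iteratedDerivWithin_Ici_eq_Icc_zero _ hδ β]
  have hαβ : ((α + β : ℕ) : WithTop ℕ∞) ≤ ((⊤ : ℕ∞) : WithTop ℕ∞) := by exact_mod_cast le_top
  have he₀ : (0 : ℝ) ∈ Ioo (-r) r := mem_Ioo.2 ⟨neg_lt_zero.2 hr, hr⟩
  exact Literature.Analysis.Calculus.iteratedDeriv_iteratedDerivWithin_comm_openFst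
    (contDiffOn_logZct_poly6 C η w c m2 μ2 hw hm hμ d20 d01 d21 d02 d22 d40 (n := ⊤)) isOpen_Ioo (uniqueDiffOn_Icc hδ)
    hαβ he₀ ⟨le_rfl, hδ.le⟩ (zero_mem_closure_interior_Icc hδ)

/-- `log Z^{ct}` with the FOUR-letter polynomial of BRICKS 14/16 is jointly `C^n` on the slab of §2. [cite: Balaban1983Higgs3,
(1.20) p.416, (1.24) p.417] -/
theorem contDiffOn_logZct_poly (hw : 0 < w) (hm : 0 < m2) (hμ : 0 < μ2) (d20 d01 d21 d40 : ℝ) {n : ℕ∞} :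
    ContDiffOn ℝ n (fun p : ℝ × ℝ => Real.log (∫ z : JCfg P j N, fibre C η w c m2 μ2
        (fun u l => d20 * u ^ 2 + d01 * l + d21 * (u ^ 2 * l) + d40 * u ^ 4) (fun _ => 1) p z))
      ((Ioo (-(min 1 (m2 / (4 * (|d20| + |d21| + |d40|) + 4)))) (min 1 (m2 / (4 * (|d20| + |d21| + |d40|) + 4))))
        ×ˢ Icc 0 (min 1 (m2 / (4 * |d01| + 4)))) := by
  refine (contDiffOn_integral_fibre C η w c m2 μ2 hw hμ (convex_Ioo _ _) (convex_Icc _ _) (fun _ hs => hs.1)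
    (contDiff_poly d20 d01 d21 d40) (poly_slab_pos hm d20 d01 d21 d40) (ExpGrowth.const 1)).log ?_
  intro p hp
  exact (integral_fibre_one_pos C η w c m2 μ2 hw hμ (mem_prod.1 hp).2.1 (poly_slab_pos hm d20 d01 d21 d40 p hp)).ne'

/-- **THE SAME FOR BRICK 16's FOUR-LETTER `log Z^{ct}`** (`δm²_{(2,0)}e² + δm²_{(0,1)}λ + δm²_{(2,1)}e²λ + δm²_{(4,0)}e⁴`), every `(α,β)`:
`∂^α_e[∂^β_{λ,+} log Z^{ct}(e,·)(0)]∣₀ = ∂^β_{λ,+}[∂^α_e log Z^{ct}(·,λ)∣₀](0⁺)` — in particular BRICK 16's `(2,1)` vacuum datum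
(`iteratedDeriv 2 (e ↦ iteratedDerivWithin 1 (λ ↦ log Z^{ct}) (Ici 0) 0) 0`) is order-independent.
[cite: Balaban1983Higgs3, (1.24) p.417, p.418] [cite: Coleman2012, §4.1 Thm. 4.3] -/
theorem iteratedDeriv_iteratedDerivWithin_logZct_comm_poly (hw : 0 < w) (hm : 0 < m2) (hμ : 0 < μ2)
    (d20 d01 d21 d40 : ℝ) (α β : ℕ) :
    iteratedDeriv α (fun e : ℝ => iteratedDerivWithin β (fun lam : ℝ => Real.log (∫ p : JCfg P j N,
        J C η w c (m2 + (d20 * e ^ 2 + d01 * lam + d21 * (e ^ 2 * lam) + d40 * e ^ 4)) μ2 e p *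
          Real.exp (-(lam * ∑ y : Site P j, w * ‖p.2 y‖ ^ 4)))) (Ici 0) 0) 0
      = iteratedDerivWithin β (fun lam : ℝ => iteratedDeriv α (fun e : ℝ => Real.log (∫ p : JCfg P j N,
        J C η w c (m2 + (d20 * e ^ 2 + d01 * lam + d21 * (e ^ 2 * lam) + d40 * e ^ 4)) μ2 e p *
          Real.exp (-(lam * ∑ y : Site P j, w * ‖p.2 y‖ ^ 4)))) 0) (Ici 0) 0 := by
  set δ : ℝ := min 1 (m2 / (4 * |d01| + 4)) with hδdef
  have hδ : 0 < δ := delta_pos hm d01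
  set Φ : ℝ × ℝ → ℝ := fun p => Real.log (∫ z : JCfg P j N, fibre C η w c m2 μ2
      (fun u l => d20 * u ^ 2 + d01 * l + d21 * (u ^ 2 * l) + d40 * u ^ 4) (fun _ => 1) p z) with hΦdef
  have hΦ : ∀ e lam : ℝ, Real.log (∫ p : JCfg P j N,
        J C η w c (m2 + (d20 * e ^ 2 + d01 * lam + d21 * (e ^ 2 * lam) + d40 * e ^ 4)) μ2 e p *
          Real.exp (-(lam * ∑ y : Site P j, w * ‖p.2 y‖ ^ 4))) = Φ (e, lam) := by
    intro e lam
    simp only [hΦdef, fibre_apply, mul_one]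
  simp only [hΦ]
  have hL : (fun e => iteratedDerivWithin β (fun s => Φ (e, s)) (Ici 0) 0)
      = fun e => iteratedDerivWithin β (fun s => Φ (e, s)) (Icc 0 δ) 0 := by
    funext e
    exact iteratedDerivWithin_Ici_eq_Icc_zero _ hδ β
  rw [hL, iteratedDerivWithin_Ici_eq_Icc_zero _ hδ β]
  have hαβ : ((α + β : ℕ) : WithTop ℕ∞) ≤ ((⊤ : ℕ∞) : WithTop ℕ∞) := by exact_mod_cast le_top
  exact Literature.Analysis.Calculus.iteratedDeriv_iteratedDerivWithin_comm_openFst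
    (contDiffOn_logZct_poly C η w c m2 μ2 hw hm hμ d20 d01 d21 d40 (n := ⊤)) isOpen_Ioo (uniqueDiffOn_Icc hδ)
    hαβ (mem_Ioo.2 ⟨neg_lt_zero.2 (radius_pos hm d20 d21 d40), radius_pos hm d20 d21 d40⟩) ⟨le_rfl, hδ.le⟩
    (zero_mem_closure_interior_Icc hδ)

end Vacuum

end Literature.MathematicalPhysics.QuantumFieldTheory.Balaban1983to89.B3Eq123IndexTwoOneOrders

end
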